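import Summits.ResolutionOfSingularities.ResolutionOfSingularities.Theorems.MarkedTransferCampaignW46WWalkStepCore
import HarnessLib

/-!
# [OURS · L1 W4.6 rung (iii-2)] THE W-WALK: the formal step in MODEL FORM — the `y`-chart via the swap, and the cleaning shear;
# the swap and shear AUTOMORPHISMS of `K⟦t, y, z⟧`

Cell `res-hironaka`, LADDER-RESOLUTION rung L (D-0089), slot W4.6 rung (iii); seat res-L1-s46-pv-5 (gen 6), plan
`HOME/L/res-L1-s46-pv-5/W-WALK-PLAN.md` §3 [E] / §4. Host route MarkedTransfer, `--supports stmt-ResolutionOfSingularities-16155 --as helper`;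
kind definition (`swapEquiv`, `shearEquiv`).

WHAT.
* `swapEquiv : K⟦X⟧ ≃ₐ[K] K⟦X⟧` (`t ↔ y`, an involution) and `shearEquiv γ` (`z ↦ z − γt`, inverse `z ↦ z + γt`), built from
  `MvPowerSeries.substAlgHom`; they act as `swapTY` / `shearZ γ` (`…WWalkSubst`).
* `exists_ringEquiv_transform_wAnchor_V` — in the `y`-chart (`i₀ = 1`) at a point with `t`-coordinate `0` (the sharp-vertical direction),
  after composing the Cohen coordinates with `swapEquiv`: `E″(f′) = w″ · (z^p + chartT p 0 (swapTY f))` — the model's `V`-step before cleaning.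
* `exists_ringEquiv_clean` — composing with `shearEquiv γ` turns `w′ · (z^p + chartT p l f)` into `w″ · (z^p + stepT p l γ f)` (characteristic
  `p`, `…WWalkSubst.subst_shearS_generator`), for ANY `γ` (the walk takes `γ^p =` the coefficient of `t^p`).

HONEST FRAMING. OURS; nothing here is a statement of H. Hironaka's manuscript [Hironaka2017] and nothing of it is used. AI-written;
AI review is weaker than expert review. No `sorry`; axioms standard. [cite: Matsumura1987, Thm. 8.11]; chart calculus [Hauser2010] §§F–G.
-/

noncomputable section

set_option linter.dupNamespace false -- mandated namespace of this single-conjunct summit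

open MvPowerSeries IsLocalRing
open Literature.AlgebraicGeometry.Resolution

namespace Summit.ResolutionOfSingularities.ResolutionOfSingularities.Theorems

namespace CampaignW46

namespace WWalk

open CampaignW46.FormalChart
open CampaignW46.AtomGerm (X_some_ne_zero)

section Automorphisms

variable {K : Type*} [Field K]

/-- **The swap automorphism `t ↔ y` of `K⟦t,y,z⟧`.** [folklore] -/
def swapEquiv : MvPowerSeries (Option (Fin 2)) K ≃ₐ[K] MvPowerSeries (Option (Fin 2)) K :=
  AlgEquiv.ofAlgHom (substAlgHom hasSubst_swapS) (substAlgHom hasSubst_swapS)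
    (by ext1 f; rw [AlgHom.comp_apply, substAlgHom_apply, substAlgHom_apply, subst_swapS_eq, subst_swapS_eq, swapTY_swapTY]; rfl)
    (by ext1 f; rw [AlgHom.comp_apply, substAlgHom_apply, substAlgHom_apply, subst_swapS_eq, subst_swapS_eq, swapTY_swapTY]; rfl)

/-- `swapEquiv` acts as `swapTY`. [folklore] -/
theorem swapEquiv_apply (f : MvPowerSeries (Option (Fin 2)) K) : swapEquiv f = swapTY f := by
  change substAlgHom hasSubst_swapS f = swapTY f
  rw [substAlgHom_apply, subst_swapS_eq]

/-- Shearing by `γ` and then by `−γ` is the identity. [folklore] -/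
theorem subst_shearS_neg_subst_shearS (γ : K) (f : MvPowerSeries (Option (Fin 2)) K) :
    subst (shearS (-γ)) (subst (shearS γ) f) = f := by
  rw [subst_comp_subst_apply (hasSubst_shearS γ) (hasSubst_shearS (-γ))]
  have : (fun s => subst (shearS (-γ)) (shearS γ s)) = (X : Option (Fin 2) → MvPowerSeries (Option (Fin 2)) K) := by
    have hS := hasSubst_shearS (K := K) (-γ)
    funext o
    rcases o with _ | k
    · rw [shearS_none, subst_sub hS, subst_mul hS, subst_C, subst_X hS, subst_X hS, shearS_none, shearS_zero, map_neg]; ring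
    · fin_cases k
      · exact subst_X hS _
      · exact subst_X hS _
  rw [this, subst_self]; rfl

/-- **The cleaning shear automorphism `z ↦ z − γt` of `K⟦t,y,z⟧`.** [folklore] -/
def shearEquiv (γ : K) : MvPowerSeries (Option (Fin 2)) K ≃ₐ[K] MvPowerSeries (Option (Fin 2)) K :=
  AlgEquiv.ofAlgHom (substAlgHom (hasSubst_shearS γ)) (substAlgHom (hasSubst_shearS (-γ)))
    (by
      ext1 f
      rw [AlgHom.comp_apply, substAlgHom_apply, substAlgHom_apply]
      have h := subst_shearS_neg_subst_shearS (-γ) f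
      rw [neg_neg] at h
      exact h)
    (by ext1 f; rw [AlgHom.comp_apply, substAlgHom_apply, substAlgHom_apply]; exact subst_shearS_neg_subst_shearS γ f)

/-- `shearEquiv γ` acts as `subst (shearS γ)`. [folklore] -/
theorem shearEquiv_apply (γ : K) (f : MvPowerSeries (Option (Fin 2)) K) : shearEquiv γ f = subst (shearS γ) f := by
  change substAlgHom (hasSubst_shearS γ) f = subst (shearS γ) f
  rw [substAlgHom_apply]

/-- **Cleaning** (characteristic `p`): composing Cohen coordinates with `shearEquiv γ` turns `w′ · (z^p + chartT p l f)` into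
`w″ · (z^p + stepT p l γ f)`. [cite: Hauser2010, §G] -/
theorem exists_ringEquiv_clean {p : ℕ} [Fact p.Prime] [CharP K p] {C : Type*} [CommRing C] (E' : C ≃+* MvPowerSeries (Option (Fin 2)) K)
    (x : C) (w' : MvPowerSeries (Option (Fin 2)) K) (hw' : IsUnit w') (l γ : K) (f : MvPowerSeries (Option (Fin 2)) K)
    (hE' : E' x = w' * (X none ^ p + chartT p l f)) :
    ∃ (E'' : C ≃+* MvPowerSeries (Option (Fin 2)) K) (w'' : MvPowerSeries (Option (Fin 2)) K),
      IsUnit w'' ∧ E'' x = w'' * (X none ^ p + stepT p l γ f) := by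
  refine ⟨E'.trans (shearEquiv γ).toRingEquiv, shearEquiv γ w', hw'.map _, ?_⟩
  rw [RingEquiv.trans_apply, hE']
  change shearEquiv γ (w' * (X none ^ p + chartT p l f)) = _
  rw [map_mul, shearEquiv_apply γ (X none ^ p + chartT p l f), subst_shearS_generator]

end Automorphisms

/-! ## The `y`-chart: the sharp-vertical step via the swap -/

section VChart

variable {p : ℕ} [hp : Fact p.Prime] {K : Type} [Field K]
  {R : Type} [CommRing R] [IsLocalRing R] [IsNoetherianRing R]
  {L : Type} [CommRing L] [IsLocalRing L] [IsNoetherianRing L]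
  (g : R →+* L) (hg : (maximalIdeal R).map g ≤ maximalIdeal L)
  (E₀ : AdicCompletion (maximalIdeal R) R ≃+* MvPowerSeries (Option (Fin 2)) K)
  (c : Option (Fin 2) → R) (hc : Ideal.span (Set.range c) = maximalIdeal R)
  (hcX : ∀ j, E₀ (algebraMap R (AdicCompletion (maximalIdeal R) R) (c j)) - MvPowerSeries.X j ∈
    maximalIdeal (MvPowerSeries (Option (Fin 2)) K) ^ 2)
  (i₀ : Fin 2) (e : Option (Fin 2) → L) (he : ∀ j, g (c j) = g (c (some i₀)) * e j)
  (τ : Option (Fin 2) → R)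
  (hgen : Ideal.span (Set.range fun j : Option (Fin 2) =>
    if j = some i₀ then g (c (some i₀)) else e j - g (τ j)) = maximalIdeal L)
  (hres : ∀ y : L, ∃ r : R, y - g r ∈ maximalIdeal L)
  (hdim : (Fintype.card (Option (Fin 2)) : WithBot ℕ∞) ≤ ringKrullDim L)

/-- The `y`-chart family with trivial translations is the swap-conjugate of `thetaT 0`. [folklore] -/
theorem subst_yChart_eq_swap (h : MvPowerSeries (Option (Fin 2)) K) :
    subst (fun j : Option (Fin 2) => if j = some (1 : Fin 2) then (X (some 1) : MvPowerSeries (Option (Fin 2)) K)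
      else X (some 1) * (X j + MvPowerSeries.C 0)) h = swapTY (subst (thetaT (0 : K)) (swapTY h)) := by
  have hT := hasSubst_thetaT (K := K) 0
  have hS := hasSubst_swapS (K := K)
  -- the intermediate family `F₁ s = thetaT 0 (swap s)`
  have hF₁ : (fun s : Option (Fin 2) => subst (thetaT (0 : K)) ((swapS (K := K)) s)) =
      (fun o => Option.elim o (X (some 0) * X none) ![X (some 0) * (X (some 1) + MvPowerSeries.C (0 : K)), X (some 0)] :
        Option (Fin 2) → MvPowerSeries (Option (Fin 2)) K) := by
    funext o
    rcases o with _ | k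
    · change subst (thetaT 0) (swapS none) = X (some 0) * X none
      rw [swapS_none, subst_X hT, thetaT_none]
    · fin_cases k
      · change subst (thetaT 0) (swapS (some 0)) = X (some 0) * (X (some 1) + MvPowerSeries.C 0)
        rw [swapS_zero, subst_X hT, thetaT_one]
      · change subst (thetaT 0) (swapS (some 1)) = X (some 0)
        rw [swapS_one, subst_X hT, thetaT_zero]
  have hF₁S : HasSubst (fun o : Option (Fin 2) => Option.elim o (X (some 0) * X none)
      ![X (some 0) * (X (some 1) + MvPowerSeries.C (0 : K)), X (some 0)] : Option (Fin 2) → MvPowerSeries (Option (Fin 2)) K) := by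
    refine hasSubst_of_constantCoeff_zero fun o => ?_
    rcases o with _ | k
    · simp
    · fin_cases k
      · change MvPowerSeries.constantCoeff (X (some 0) * (X (some 1) + MvPowerSeries.C (0 : K)) : MvPowerSeries (Option (Fin 2)) K) = 0; simp
      · exact MvPowerSeries.constantCoeff_X _
  rw [← subst_swapS_eq, ← subst_swapS_eq h, subst_comp_subst_apply hS hT, hF₁, subst_comp_subst_apply hF₁S hS]
  congr 1
  funext o
  rcases o with _ | k
  · change X (some 1) * (X none + MvPowerSeries.C 0) = subst swapS (X (some 0) * X none)
    rw [subst_mul hS, subst_X hS, subst_X hS, swapS_zero, swapS_none, map_zero, add_zero]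
  · fin_cases k
    · change X (some 1) * (X (some 0) + MvPowerSeries.C 0) = subst swapS (X (some 0) * (X (some 1) + MvPowerSeries.C 0))
      rw [subst_mul hS, subst_add hS, subst_X hS, subst_X hS, subst_C, swapS_zero, swapS_one]
    · change (X (some 1) : MvPowerSeries (Option (Fin 2)) K) = subst swapS (X (some 0))
      rw [subst_X hS, swapS_zero]

include hg hc he hcX hgen hres hdim in
/-- **THE FORMAL `V`-STEP** (chart `y = X (some 1)` at a point with `t`-coordinate `0`, the sharp-vertical direction): after the swap of
the Cohen coordinates, `E″(f′) = w″ · (z^p + chartT p 0 (swapTY f))`. [cite: Matsumura1987, Thm. 8.11] [cite: Hauser2010, §§F–G] -/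
theorem exists_ringEquiv_transform_wAnchor_V (hi₀ : i₀ = 1)
    (hτt : MvPowerSeries.constantCoeff (E₀ (algebraMap R (AdicCompletion (maximalIdeal R) R) (τ (some 0)))) = 0)
    (f : MvPowerSeries (Option (Fin 2)) K) (hfP2 : LowVanish (p + 1) f) (f₀ : R)
    (w₀ : MvPowerSeries (Option (Fin 2)) K) (hw₀ : IsUnit w₀)
    (hf₀ : E₀ (algebraMap R (AdicCompletion (maximalIdeal R) R) f₀) = w₀ * (MvPowerSeries.X none ^ p + f))
    (f' : L) (hf' : g f₀ = g (c (some i₀)) ^ p * f') (hf'𝔪 : f' ∈ maximalIdeal L ^ p) :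
    ∃ (E' : AdicCompletion (maximalIdeal L) L ≃+* MvPowerSeries (Option (Fin 2)) K) (w' : MvPowerSeries (Option (Fin 2)) K),
      IsUnit w' ∧ E' (algebraMap L (AdicCompletion (maximalIdeal L) L) f') = w' * (MvPowerSeries.X none ^ p + chartT p (0 : K) (swapTY f)) := by
  subst hi₀
  obtain ⟨-, E', w', G, hw', hE', hG⟩ := exists_ringEquiv_transform_wAnchor g hg E₀ c hc hcX 1 e he τ hgen hres hdim f hfP2 f₀ w₀ hw₀ hf₀ f' hf' hf'𝔪
  have hfam : (fun j : Option (Fin 2) => if j = some (1 : Fin 2) then (X (some 1) : MvPowerSeries (Option (Fin 2)) K)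
      else X (some 1) * (X j + MvPowerSeries.C (if j = none then 0 else
        MvPowerSeries.constantCoeff (E₀ (algebraMap R (AdicCompletion (maximalIdeal R) R) (τ j)))))) =
      (fun j : Option (Fin 2) => if j = some (1 : Fin 2) then (X (some 1) : MvPowerSeries (Option (Fin 2)) K)
        else X (some 1) * (X j + MvPowerSeries.C 0)) := by
    funext j
    rcases j with _ | k
    · simp
    · fin_cases k
      · simp [hτt]
      · simp
  -- `X_y^p · G = swapTY (t^p · (z^p + chartT p 0 (swapTY f)))`
  have hsw : LowVanish p (swapTY f) := lowVanish_swapTY fun e he => hfP2 e (by omega)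
  rw [hfam, subst_yChart_eq_swap, ← subst_swapS_eq (X none ^ p + f), subst_add hasSubst_swapS, subst_pow hasSubst_swapS,
    subst_X hasSubst_swapS, swapS_none, subst_swapS_eq, subst_thetaT_generator (0 : K) hsw, ← subst_swapS_eq,
    subst_mul hasSubst_swapS, subst_pow hasSubst_swapS, subst_X hasSubst_swapS, swapS_zero] at hG
  have hGeq : G = subst swapS (X none ^ p + chartT p 0 (swapTY f)) :=
    mul_left_cancel₀ (pow_ne_zero p (X_some_ne_zero (1 : Fin 2))) hG
  refine ⟨E'.trans swapEquiv.toRingEquiv, swapEquiv w', hw'.map _, ?_⟩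
  rw [RingEquiv.trans_apply, hE']
  change swapEquiv (w' * G) = _
  rw [map_mul, hGeq, swapEquiv_apply (subst swapS _), subst_swapS_eq, swapTY_swapTY]

include hg hc hcX hres hdim in
omit e he τ hgen i₀ in
/-- **EXCLUSION OF THE `z`-CHART ORIGIN for a general window germ**: with chart data in the `z`-chart (`i = none`; the point is the
origin of the `z`-chart, direction `(0:0:1)`), the controlled transform `f′` is a unit — so the point is not singular (`f′ ∉ 𝔪_L^p`).
Reason: `(z^p + f)(z(t+τ_t), z(y+τ_y), z) = z^p (1 + z·H)` since `ord f ≥ p + 1`. [cite: Matsumura1987, Thm. 8.11] [cite: Hauser2010, §F] -/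
theorem not_mem_pow_of_zChart (eZ : Option (Fin 2) → L) (heZ : ∀ j, g (c j) = g (c none) * eZ j) (τZ : Option (Fin 2) → R)
    (hgenZ : Ideal.span (Set.range fun j : Option (Fin 2) => if j = none then g (c none) else eZ j - g (τZ j)) = maximalIdeal L)
    (f : MvPowerSeries (Option (Fin 2)) K) (hfP2 : LowVanish (p + 1) f) (f₀ : R)
    (w₀ : MvPowerSeries (Option (Fin 2)) K) (hw₀ : IsUnit w₀)
    (hf₀ : E₀ (algebraMap R (AdicCompletion (maximalIdeal R) R) f₀) = w₀ * (MvPowerSeries.X none ^ p + f))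
    (f' : L) (hf' : g f₀ = g (c none) ^ p * f') : f' ∉ maximalIdeal L ^ p := by
  classical
  intro hf'𝔪
  set ĝ := adicCompletionMap (maximalIdeal R) (maximalIdeal L) g hg with hĝ
  set φ : (MvPowerSeries (Option (Fin 2)) K) →+* AdicCompletion (maximalIdeal L) L := ĝ.comp E₀.symm.toRingHom with hφ
  set ofL := algebraMap L (AdicCompletion (maximalIdeal L) L) with hofL
  set ofR := algebraMap R (AdicCompletion (maximalIdeal R) R) with hofR
  set τκ : Option (Fin 2) → K := fun j => MvPowerSeries.constantCoeff (E₀ (ofR (τZ j))) with hτκ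
  have hφE₀ : ∀ x, φ (E₀ x) = ĝ x := fun x => by
    rw [hφ, RingHom.comp_apply]
    change ĝ (E₀.symm (E₀ x)) = ĝ x
    rw [RingEquiv.symm_apply_apply]
  have hĝ_of : ∀ x : R, ĝ (ofR x) = ofL (g x) := fun x => by
    rw [hofR, hofL, hĝ, adicCompletionMap_algebraMap]
  haveI : IsNoetherianRing (AdicCompletion (maximalIdeal L) L) := isNoetherianRing_adicCompletion_maximalIdeal L
  obtain ⟨E', hE'C, hE'i, hE'j⟩ := exists_ringEquiv_completion_chart g hg E₀ c hc hcX none eZ heZ τZ hgenZ hres hdim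
  set ψ : (MvPowerSeries (Option (Fin 2)) K) →+* (MvPowerSeries (Option (Fin 2)) K) := (E' : _ →+* (MvPowerSeries (Option (Fin 2)) K)).comp φ with hψ
  have hψapp : ∀ x, ψ x = E' (φ x) := fun x => rfl
  have hψC : ∀ l, ψ (MvPowerSeries.C l) = MvPowerSeries.C l := fun l => hE'C l
  have hψi : ψ (X none) = X none := hE'i
  have hψj : ∀ j, j ≠ none → ψ (X j) = X none * (X j + MvPowerSeries.C (τκ j)) := fun j hj => hE'j j hj
  set Θ : Option (Fin 2) → MvPowerSeries (Option (Fin 2)) K := fun j => if j = none then (X none : MvPowerSeries (Option (Fin 2)) K)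
    else X none * (X j + MvPowerSeries.C (τκ j)) with hΘ
  have hΘsub : HasSubst Θ := hasSubst_chart none τκ
  have hψsubst : ∀ h, ψ h = subst Θ h := fun h => ringHom_eq_subst_of_apply_X ψ hψC none τκ hψi hψj h
  have hΘi : Θ none = X none := by rw [hΘ]; exact if_pos rfl
  have hΘmem : ∀ j, Θ j ∈ Ideal.span {(X none : MvPowerSeries (Option (Fin 2)) K)} := by
    intro j
    by_cases hj : j = none
    · rw [hj, hΘi]; exact Ideal.subset_span rfl
    · rw [hΘ]; simp only [if_neg hj]; exact Ideal.mul_mem_right _ _ (Ideal.subset_span rfl)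
  have hfmem : f ∈ maximalIdeal (MvPowerSeries (Option (Fin 2)) K) ^ (p + 1) :=
    (Literature.RingTheory.MvPowerSeries.Jets.mem_maximalIdeal_pow_iff).mpr hfP2
  obtain ⟨H, hH⟩ : ∃ H : MvPowerSeries (Option (Fin 2)) K, subst Θ f = X none ^ (p + 1) * H := by
    have h := CampaignW46.AtomGerm.subst_mem_pow_of_mem_maximalIdeal_pow hΘsub hΘmem hfmem
    rw [Ideal.span_singleton_pow] at h
    exact Ideal.mem_span_singleton'.1 h |>.imp fun H hH => by rw [← hH, mul_comm]
  set G₁ : MvPowerSeries (Option (Fin 2)) K := 1 + X none * H with hG₁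
  have hψzf : ψ (MvPowerSeries.X none ^ p + f) = X none ^ p * G₁ := by
    rw [map_add, map_pow, hψi, hψsubst f, hH, hG₁]; ring
  have hEgf₀ : E' (ofL (g f₀)) = ψ w₀ * (X none ^ p * G₁) := by
    rw [← hĝ_of, ← hφE₀, ← hψapp, hf₀, map_mul, hψzf]
  -- `E′ (g c_z) = X_z · unit`
  obtain ⟨w₂, hw₂, hEci⟩ : ∃ w₂ : MvPowerSeries (Option (Fin 2)) K, IsUnit w₂ ∧ E' (ofL (g (c none))) = X none * w₂ := by
    obtain ⟨w₂, hw₂, h⟩ := CampaignW46.AtomGerm.exists_isUnit_image_adapted' none hΘsub hΘi hΘmem (E₀ (ofR (c none))) (hcX none)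
    exact ⟨w₂, hw₂, by rw [← hĝ_of, ← hφE₀, ← hψapp, hψsubst, h]⟩
  have hw₀' : IsUnit (ψ w₀) := hw₀.map ψ
  have hXz : (X none : MvPowerSeries (Option (Fin 2)) K) ≠ 0 := by
    intro h
    have := congrArg (MvPowerSeries.coeff (Finsupp.single none 1)) h
    rw [MvPowerSeries.coeff_X, if_pos rfl, map_zero] at this
    exact one_ne_zero this
  have hEf' : w₂ ^ p * E' (ofL f') = ψ w₀ * G₁ := by
    have h1 : E' (ofL (g f₀)) = (X none * w₂) ^ p * E' (ofL f') := by
      rw [hf', map_mul, map_pow, map_mul, map_pow, hEci]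
    have h2 : (X none : MvPowerSeries (Option (Fin 2)) K) ^ p * (w₂ ^ p * E' (ofL f')) = X none ^ p * (ψ w₀ * G₁) := by
      rw [← mul_assoc, ← mul_pow, ← h1, hEgf₀]; ring
    exact mul_left_cancel₀ (pow_ne_zero p hXz) h2
  -- `G₁` is a unit, but `E′ f′ ∈ 𝔪^p`
  have hG₁unit : IsUnit G₁ := by
    rw [hG₁, MvPowerSeries.isUnit_iff_constantCoeff]
    simp
  have hmem : ψ w₀ * G₁ ∈ maximalIdeal (MvPowerSeries (Option (Fin 2)) K) ^ p := by
    rw [← hEf']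
    exact Ideal.mul_mem_left _ _ (ringEquiv_mem_maximalIdeal_pow E' ((CampaignW46.AtomGerm.mem_maximalIdeal_pow_iff_algebraMap p f').mp hf'𝔪))
  have hunit : IsUnit (ψ w₀ * G₁) := hw₀'.mul hG₁unit
  have h1 : ψ w₀ * G₁ ∈ maximalIdeal (MvPowerSeries (Option (Fin 2)) K) := Ideal.pow_le_self hp.out.ne_zero hmem
  exact (IsLocalRing.mem_maximalIdeal _).mp h1 hunit

end VChart

end WWalk

end CampaignW46

end Summit.ResolutionOfSingularities.ResolutionOfSingularities.Theorems

end
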